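import Summits.ABC.IUTFork.Repair.RHSzpiroBadCutFreyWindowDegree
import HarnessLib

/-!
# R-H row 2 «szpiro-bad-datum-cut», ROUND-2 KERNEL RESIDUE (part 4): the REYSSAT triple `2 + 3¹⁰·109 = 23⁵` (R-W F02, the critical row of
# WINDOW-TABLE) at ALL FOUR of its Szpiro-bad primes `l ∈ {13, 17, 19, 109}` — admissible-minus-(P6), SZPIRO-BAD (tight certificate at `l = 13`,
# R-W margin `−0.333`), IN THE WINDOW (`l = 13` by part 1, `l = 17, 19, 109` by the degree-aware criterion of part 3), hence
# `H⋆₂ = HStarSzpiroBadCut` refuted there MODULO exactly (P6) and (P7)-existence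

PROOF-ONLY file (0 definitions, no instance, no notation) of the abc-iut cell (D-0079 rescue sub-cell R-H, seat abc-iut-rh-typ-2 gen 2); sequel to
parts 1–3 (`RHSzpiroBadCutFreyResidue` p469508, `…F18` p469621, `…WindowDegree`) and to gen 0's `RHSzpiroBadCutReyssat.lean` (p461207: the model-free
kernel NEG `not_i06StarCellsAt_reyssat13`, and `not_window_of_hStar_reyssat13` which took `UP`/core/(P2)/(P5)/(P6)/Szpiro-bad as HYPOTHESES) and
`RHSzpiroBadCutFreyFamily.lean` (p462474: `not_i06StarCellsAt_F02_l13/_l17/_l19/_l109`). TAKES NO SIDE on [IUTchIII] Cor. 3.12 or on any author.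

THE POINT. `λ_R = 2/23⁵ = 2/6436343` (`a = 2`, `b = 3¹⁰·109 = 6436341`, `c = 23⁵`), `j(λ_R) = 2⁶(cb+a²)³/(abc/2)²`: pole divisor `3²⁰·23¹⁰·109²`
(`I = {3, 23, 109}`, `h = (20, 10, 2)`; the place over `2` is GOOD, `v₂(abc) = 1`), `N = 2⁶(cb+4)³` coprime to `3·23·109`.
WHAT IS PROVED (BY NAME from parts 1–3 and abc-iut-c312-d1's dictionary p462751): `jInv_reyssat'`, `factorisation_reyssat`, `ratPoint_reyssat_mem_UP`,
`admitsCore_reyssat`; for each `l ∈ {13, 17, 19, 109}`: `condP2_reyssat_l<l>`, `condP5_reyssat_l<l>` (the place over `23`),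
**`szpiroBad_reyssat_l<l>`** (certificates `(C, A, B) = (15, 89, 124)` at `l = 13` — `6·14·12·15 = 15120 ≤ 15130 = 89·17·10`, `6·13·18·15 = 21060 ≤ 21080`,
`7521⁸⁹·63¹²⁴ < 20¹²⁴·3³⁰⁰·23¹⁵⁰·109³⁰` (570-digit integers); `(3, 18, 23)` at `17`; `(2, 12, 15)` at `19`; `(1, 6, 7)` at `109`),
**`not_deep_reyssat_l<l>`** (window: `l = 13`: `20·10·14 = 2800 ≤ 3016 = 8·13·29` — part 1, no degree input; `l = 17`: `k₃ = 7` (`3⁷ = 2187 ≤ 4896 = 17·288`),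
`20·252 = 5040 ≤ 22168`; `l = 19`: `k₃ = 8`; `l = 109`: `k₃ = 12`, `k₂₃ = 4` — part 3, `[K:ℚ] ≥ l(l²−1)`),
**`isEmpty_thetaVolumeDatumAt_reyssat_l<l>_of_hStar`** (`HStarSzpiroBadCut ∧ CondP6 ⟹ IsEmpty (ThetaVolumeDatumAt λ_R l)`) and
**`not_hStarSzpiroBadCut_of_condP6_of_nonempty_reyssat_l<l>`** (`CondP6 ∧ Nonempty ⟹ ¬ HStarSzpiroBadCut`).
So gen 0's `not_window_of_hStar_reyssat13` loses five of its six hypotheses (only (P6) remains) and its conclusion «every datum deep» becomes «no datum».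
HONEST FRAMING: `HStarSzpiroBadCut`, `I06StarCellsAt`, `CondP6` are hypotheses / predicates, never asserted; NOTHING here asserts that abc is proved or
refuted, that Θ-data exist at `λ_R`, or takes a side on [IUTchIII] Cor. 3.12 or on any author; typed ≠ proved; refuted-as-typed ≠ refuted-in-print.
[cite: Mochizuki2012, IUTchI Def. 3.1 (b)(c) p. 61–62; IUTchIII Cor. 3.12 p. 173–174, Rmk. 3.12.2 (ii) p. 191; IUTchIV Prop. 1.2 (i) p. 10, Thm. 1.10 p. 22–24,
Cor. 2.2 (ii) proof (P2)(P5)(P6)(P7) p. 43–46] [cite: MochizukiGenEll2010, Ex. 1.3 (i) p. 5, Def. 3.3 p. 12] [cite: DupuyHilado2025, §3.3, §3.4]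
[cite: SilvermanAEC2009, Prop. III.1.7(b)] [claim: Mochizuki2012, status: disputed] for every IUT locution. Axioms: standard.
-/

noncomputable section

open Set Function NumberField IsDedekindDomain
open scoped Pointwise

namespace Summit.ABC.IUTFork.Repair.RHSzpiroBadCutFreyResidue

open Thm311 Thm311.Real Cor312 Cor312Vol Cor312Prov Literature.IUT.LogThetaLattice Literature.IUT.LogVolume
  Literature.IUT.HodgeTheaters Literature.IUT.LogVolume.ThetaData Literature.AnabelianGeometry.AbsoluteAnabelian
open Literature.NumberTheory.DiophantineGeometry.GenEll Summit.ABC.IUTFork.Conditional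
open Summit.ABC.IUTFork.Repair.RHSzpiroBadCut Summit.ABC.IUTFork.Repair.RHSzpiroBadCutFreyFamily


/-! ## §0. Two rational-point packagings of parts 1–3 (power-outside certificate; degree-aware window from the factorised pole divisor) -/

section RatPoint

open Rat.HeightOneSpectrum Literature.NumberTheory.DiophantineGeometry.UniformABCConjecture

variable {q : ℚ} {N Dn : ℕ} {I : Finset ℕ} {e : ℕ → ℕ}

/-- **The tight Szpiro-bad certificate, power-outside form**: as part 3's `szpiroBad_ratPoint_of_certificate_tight`, with the certificate written
`(∏_{I∖{l}} p)^A · 63^B < 20^B · (∏_{I∖{l}} p^{e_p})^C` (so that every exponent handed to `norm_num` stays small). [cite: Mochizuki2012, IUTchIV Thm. 1.10 p. 22–23]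
[claim: Mochizuki2012, status: disputed] -/
theorem szpiroBad_ratPoint_of_certificate_tight' (hI : ∀ p ∈ I, p.Prime) (he : ∀ p ∈ I, e p ≠ 0) (hD : Dn = ∏ p ∈ I, p ^ e p)
    (hj : Cor22.jInv q = (N : ℚ) / (Dn : ℚ)) (hN : N ≠ 0) (hcop : ∀ p ∈ I, ¬ p ∣ N) (h2 : 2 ∉ I) {l : ℕ} (hl : l.Prime)
    (h5 : 5 ≤ l) {A B C : ℕ} (hC : 0 < C) (hA : 6 * ((l : ℝ) + 1) * ((l : ℝ) - 1) * C ≤ A * (((l : ℝ) + 4) * ((l : ℝ) - 3)))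
    (hB : 6 * (l : ℝ) * ((l : ℝ) + 5) * C ≤ B * (((l : ℝ) + 4) * ((l : ℝ) - 3)))
    (hcert : (∏ p ∈ I.erase l, p) ^ A * 63 ^ B < 20 ^ B * (∏ p ∈ I.erase l, p ^ e p) ^ C) :
    ((l : ℝ) + 5) / 4 < (Cor22.dmod (ratPoint q) : ℝ) ∨
      6 * l * (((l : ℝ) + 5) - 4 * Cor22.dmod (ratPoint q)) / (((l : ℝ) + 4) * ((l : ℝ) - 3))
          * ((ratPoint q).logDiff + (1 - 1 / (l : ℝ)) * Cor22.logCondAvoid (ratPoint q) {2, l})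
        + 6 * l * ((l : ℝ) + 5) / (((l : ℝ) + 4) * ((l : ℝ) - 3)) * Real.log Real.pi < Cor22.logQAvoid (ratPoint q) {2, l} := by
  refine szpiroBad_ratPoint_of_certificate_tight hI he hD hj hN hcop h2 hl h5 hC hA hB ?_
  have hpow : ∏ p ∈ I.erase l, p ^ (C * e p) = (∏ p ∈ I.erase l, p ^ e p) ^ C := by
    rw [← Finset.prod_pow]
    exact Finset.prod_congr rfl fun p _ => by rw [mul_comm, pow_mul]
  rw [hpow]
  exact hcert

/-- **Degree-aware window at a rational point from the factorised pole divisor** (part 3's `not_deep_of_forall_localHeight_mul_le_of_pow_le` +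
`localHeight_mul_le_ratPoint_of_factorisation_residueChar`): exponents `k_p` with `p^{k_p} ≤ l(l²−1)` and `e_p·(l−3)(l+1) ≤ 8l((l+1)(k_p+2)+1)` on `I`
⟹ every Θ-volume datum at `(ratPoint q, l)` satisfies the window guard VERBATIM. [cite: Mochizuki2012, IUTchIII Cor. 3.12 p. 173–174; IUTchIV Thm. 1.10 p. 22–24]
[claim: Mochizuki2012, status: disputed] -/
theorem not_deep_ratPoint_of_factorisation_of_pow_le {l : ℕ} (T : Cor22.ThetaVolumeDatumAt (ratPoint q) l)
    (hI : ∀ p ∈ I, p.Prime) (hD : Dn = ∏ p ∈ I, p ^ e p) (hj : Cor22.jInv q = (N : ℚ) / (Dn : ℚ)) (hN : N ≠ 0)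
    (hcop : ∀ p ∈ I, ¬ p ∣ N) (k : ℕ → ℕ) (hk : ∀ p : ℕ, 1 < p → p ^ k p ≤ l * (l ^ 2 - 1))
    (hle : ∀ p ∈ I, (e p : ℝ) * (((l : ℝ) - 3) * ((l : ℝ) + 1)) ≤ 8 * (l : ℝ) * (((l : ℝ) + 1) * ((k p : ℝ) + 2) + 1)) :
    letI := T.instFieldF; letI := T.instNumberFieldF; letI := T.instAlgebraF; letI := T.instFieldK
    letI := T.instNumberFieldK; letI := T.instAlgebraK; letI := T.instFieldFbar; letI := T.instAlgebraFbar
    letI := T.instAlgebraKFbar; letI := T.instIsElliptic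
    ¬ (∃ (pp : Nat.Primes) (_ : 2 < (pp : ℕ)) (i : Fin (thetaIndex (pilotDataOfK T.D T.K)).lstar)
        (x₀ : (thetaIndex (pilotDataOfK T.D T.K)).Fibre (.inr pp)),
      haveI : Fact (pp : ℕ).Prime := ⟨pp.2⟩
      ((pp : ℕ) : ℝ) ^ ((((i : ℕ) : ℝ) + 2) * (4 + 2 * Real.logb (pp : ℕ) (Module.finrank ℚ T.K)) + 1) *
        ‖(exists_realising_qIdeles_pilotDataOfK T.D).choose pp x₀‖ ^ (((i : ℕ) + 1) ^ 2 - 1) < 1) := by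
  have hc : ∀ p : ℕ, (0 : ℝ) ≤ 8 * (l : ℝ) * (((l : ℝ) + 1) * ((k p : ℝ) + 2) + 1) := fun p => by positivity
  have hw := localHeight_mul_le_ratPoint_of_factorisation_residueChar hI hD hj hN hcop
    (fun p => 8 * (l : ℝ) * (((l : ℝ) + 1) * ((k p : ℝ) + 2) + 1)) hc hle
  exact not_deep_of_forall_localHeight_mul_le_of_pow_le T k hk fun v hv => hw v hv

end RatPoint

section Reyssat

/-- **The reduced pole divisor of `j(λ_R)`**, `λ_R = 2/23⁵`: `j = 2⁶(cb+4)³/(3²⁰·23¹⁰·109²)`. [cite: SilvermanAEC2009, Prop. III.1.7(b)] [claim: Mochizuki2012, status: disputed] -/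
theorem jInv_reyssat' :
    Cor22.jInv (((2 : ℕ) : ℚ) / ((6436343 : ℕ) : ℚ)) = ((4550034081061575630856781958829776704708032 : ℕ) : ℚ) / ((1716154764793810191403767369 : ℕ) : ℚ) := by
  norm_num [Cor22.jInv]

/-- The factorised pole divisor of `λ_R`, all side conditions of parts 1/3 §2 in one place. [cite: SilvermanAEC2009, Prop. III.1.7(b)] [claim: Mochizuki2012, status: disputed] -/
theorem factorisation_reyssat :
    (∀ p ∈ ({3, 23, 109} : Finset ℕ), p.Prime) ∧ (∀ p ∈ ({3, 23, 109} : Finset ℕ), (fun p : ℕ => if p = 3 then 20 else if p = 23 then 10 else 2) p ≠ 0) ∧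
    (1716154764793810191403767369 : ℕ) = ∏ p ∈ ({3, 23, 109} : Finset ℕ), p ^ (fun p : ℕ => if p = 3 then 20 else if p = 23 then 10 else 2) p ∧
    Cor22.jInv (((2 : ℕ) : ℚ) / ((6436343 : ℕ) : ℚ)) = ((4550034081061575630856781958829776704708032 : ℕ) : ℚ) / ((1716154764793810191403767369 : ℕ) : ℚ) ∧
    (4550034081061575630856781958829776704708032 : ℕ) ≠ 0 ∧ (∀ p ∈ ({3, 23, 109} : Finset ℕ), ¬ p ∣ 4550034081061575630856781958829776704708032) ∧ 2 ∉ ({3, 23, 109} : Finset ℕ) := by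
  refine ⟨?_, ?_, ?_, jInv_reyssat', by norm_num, ?_, by decide⟩
  · intro p hp
    simp only [Finset.mem_insert, Finset.mem_singleton] at hp
    rcases hp with rfl | rfl | rfl <;> norm_num
  · intro p hp
    simp only [Finset.mem_insert, Finset.mem_singleton] at hp
    rcases hp with rfl | rfl | rfl <;> norm_num
  · rw [Finset.prod_insert (by decide), Finset.prod_insert (by decide), Finset.prod_singleton]
    norm_num
  · intro p hp
    simp only [Finset.mem_insert, Finset.mem_singleton] at hp
    rcases hp with rfl | rfl | rfl <;> norm_num

/-- **`λ_R ∈ U_X(ℚ̄)`, minimally presented**. [cite: MochizukiGenEll2010, Ex. 1.3 (i) p. 5] [claim: Mochizuki2012, status: disputed] -/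
theorem ratPoint_reyssat_mem_UP : ratPoint (((2 : ℕ) : ℚ) / ((6436343 : ℕ) : ℚ)) ∈ UP :=
  (ratPoint_mem_UPle_one (by norm_num) (by norm_num)).1

/-- **`E_{λ_R}` admits a core**. [cite: Mochizuki2012, IUTchIV Cor. 2.2 (ii) proof p. 43] [claim: Mochizuki2012, status: disputed] -/
theorem admitsCore_reyssat : Cor22.AdmitsCore (ratPoint (((2 : ℕ) : ℚ) / ((6436343 : ℕ) : ℚ))) := by
  show ∀ r ∈ Cor22.coreExceptionalJ, Cor22.jInv (((2 : ℕ) : ℚ) / ((6436343 : ℕ) : ℚ)) ≠ (r : ℚ)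
  intro r hr
  rw [jInv_reyssat']
  simp only [Cor22.coreExceptionalJ, Finset.mem_insert, Finset.mem_singleton] at hr
  rcases hr with rfl | rfl | rfl | rfl <;> norm_num


/-- **(P2) at `(λ_R, 13)`**: `13` divides no local height (`h ∈ {20, 10, 2}`). [cite: Mochizuki2012, IUTchIV Cor. 2.2 (ii) proof (P2) p. 45] [claim: Mochizuki2012, status: disputed] -/
theorem condP2_reyssat_l13 : Cor22.CondP2 (ratPoint (((2 : ℕ) : ℚ) / ((6436343 : ℕ) : ℚ))) 13 := by
  obtain ⟨hI, -, hD, hj, hN, hcop, -⟩ := factorisation_reyssat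
  refine condP2_ratPoint_of_factorisation hI hD hj hN hcop fun p hp => ?_
  simp only [Finset.mem_insert, Finset.mem_singleton] at hp
  rcases hp with rfl | rfl | rfl <;> norm_num

/-- **(P5) at `(λ_R, 13)`**: the place over `23` is bad and divides neither `2` nor `13`. [cite: Mochizuki2012, IUTchIV Cor. 2.2 (ii) proof (P5) p. 46] [claim: Mochizuki2012, status: disputed] -/
theorem condP5_reyssat_l13 : Cor22.CondP5 (ratPoint (((2 : ℕ) : ℚ) / ((6436343 : ℕ) : ℚ))) 13 := by
  obtain ⟨hI, he, hD, hj, hN, hcop, -⟩ := factorisation_reyssat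
  exact condP5_ratPoint_of_factorisation hI he hD hj hN hcop (p₀ := 23) (by decide) (by norm_num) (by norm_num)

/-- **SZPIRO-BAD at `(λ_R, 13)`** — the disjunction of the cut certificate p450130 HOLDS (second disjunct, `d_mod = 1`), by the TIGHT certificate of part 3
with `(C, A, B) = (15, 89, 124)`: `(∏_{p ≠ 13} p)^89·63^124 < 20^124·∏_{p ≠ 13} p^{15·h_p}`. [cite: Mochizuki2012, IUTchIV Thm. 1.10 p. 22–23, Cor. 2.2 (ii) proof p. 46]
[claim: Mochizuki2012, status: disputed] -/
theorem szpiroBad_reyssat_l13 :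
    (((13 : ℕ) : ℝ) + 5) / 4 < (Cor22.dmod (ratPoint (((2 : ℕ) : ℚ) / ((6436343 : ℕ) : ℚ))) : ℝ) ∨
      6 * (13 : ℕ) * ((((13 : ℕ) : ℝ) + 5) - 4 * Cor22.dmod (ratPoint (((2 : ℕ) : ℚ) / ((6436343 : ℕ) : ℚ)))) / ((((13 : ℕ) : ℝ) + 4) * (((13 : ℕ) : ℝ) - 3))
          * ((ratPoint (((2 : ℕ) : ℚ) / ((6436343 : ℕ) : ℚ))).logDiff + (1 - 1 / ((13 : ℕ) : ℝ)) * Cor22.logCondAvoid (ratPoint (((2 : ℕ) : ℚ) / ((6436343 : ℕ) : ℚ))) {2, 13})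
        + 6 * (13 : ℕ) * (((13 : ℕ) : ℝ) + 5) / ((((13 : ℕ) : ℝ) + 4) * (((13 : ℕ) : ℝ) - 3)) * Real.log Real.pi < Cor22.logQAvoid (ratPoint (((2 : ℕ) : ℚ) / ((6436343 : ℕ) : ℚ))) {2, 13} := by
  obtain ⟨hI, he, hD, hj, hN, hcop, h2⟩ := factorisation_reyssat
  refine szpiroBad_ratPoint_of_certificate_tight' hI he hD hj hN hcop h2 (by norm_num) (by norm_num) (A := 89) (B := 124) (C := 15)
    (by norm_num) (by norm_num) (by norm_num) ?_
  rw [show (({3, 23, 109} : Finset ℕ)).erase 13 = ({3, 23, 109} : Finset ℕ) by decide]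
  rw [Finset.prod_insert (by decide), Finset.prod_insert (by decide), Finset.prod_singleton, Finset.prod_insert (by decide), Finset.prod_insert (by decide), Finset.prod_singleton]
  norm_num

/-- **EVERY Θ-volume datum at `(λ_R, 13)` is in the WINDOW** (¬deep, VERBATIM) by part 1's `l`-sharp criterion WITHOUT degree input: `max h = 20` and
`20·10·14 = 2800 ≤ 3016 = 8·13·29`. Existence of such a datum NOT claimed. [cite: Mochizuki2012, IUTchIII Cor. 3.12 p. 173–174; IUTchIV Thm. 1.10 p. 22–23]
[claim: Mochizuki2012, status: disputed] -/
theorem not_deep_reyssat_l13 (T : Cor22.ThetaVolumeDatumAt (ratPoint (((2 : ℕ) : ℚ) / ((6436343 : ℕ) : ℚ))) 13) :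
    letI := T.instFieldF; letI := T.instNumberFieldF; letI := T.instAlgebraF; letI := T.instFieldK
    letI := T.instNumberFieldK; letI := T.instAlgebraK; letI := T.instFieldFbar; letI := T.instAlgebraFbar
    letI := T.instAlgebraKFbar; letI := T.instIsElliptic
    ¬ (∃ (pp : Nat.Primes) (_ : 2 < (pp : ℕ)) (i : Fin (thetaIndex (pilotDataOfK T.D T.K)).lstar)
        (x₀ : (thetaIndex (pilotDataOfK T.D T.K)).Fibre (.inr pp)),
      haveI : Fact (pp : ℕ).Prime := ⟨pp.2⟩
      ((pp : ℕ) : ℝ) ^ ((((i : ℕ) : ℝ) + 2) * (4 + 2 * Real.logb (pp : ℕ) (Module.finrank ℚ T.K)) + 1) *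
        ‖(exists_realising_qIdeles_pilotDataOfK T.D).choose pp x₀‖ ^ (((i : ℕ) + 1) ^ 2 - 1) < 1) := by
  obtain ⟨hI, -, hD, hj, hN, hcop, -⟩ := factorisation_reyssat
  refine not_deep_of_forall_localHeight_mul_le T
    (localHeight_mul_le_ratPoint_of_factorisation hI hD hj hN hcop (by norm_num) fun p hp => ?_)
  simp only [Finset.mem_insert, Finset.mem_singleton] at hp
  rcases hp with rfl | rfl | rfl <;> norm_num

/-- **`H⋆₂` FORBIDS Θ-DATA AT `(λ_R, 13)` GIVEN (P6)**: under `HStarSzpiroBadCut` and (P6) at `(λ_R, 13)` the type of genuine Θ-volume data there is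
EMPTY (admissible-minus-(P6), Szpiro-bad, window — all kernel above; the I06⋆ cells refused by gen 0's `not_i06StarCellsAt_F02_l13`).
[cite: Mochizuki2012, IUTchIV Cor. 2.2 (ii) proof (P6)(P7) p. 46; IUTchIII Rmk. 3.12.2 (ii) p. 191] [claim: Mochizuki2012, status: disputed] -/
theorem isEmpty_thetaVolumeDatumAt_reyssat_l13_of_hStar (hH : HStarSzpiroBadCut) (h6 : Cor22.CondP6 (ratPoint (((2 : ℕ) : ℚ) / ((6436343 : ℕ) : ℚ))) 13) :
    IsEmpty (Cor22.ThetaVolumeDatumAt (ratPoint (((2 : ℕ) : ℚ) / ((6436343 : ℕ) : ℚ))) 13) :=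
  ⟨fun T => not_i06StarCellsAt_F02_l13 T
    (hH _ ratPoint_reyssat_mem_UP 13 (by norm_num) (by norm_num) admitsCore_reyssat condP2_reyssat_l13 condP5_reyssat_l13 h6
      szpiroBad_reyssat_l13 T (not_deep_reyssat_l13 T))⟩

/-- **`¬ H⋆₂` MODULO EXACTLY (P6) AND (P7)-EXISTENCE at the Reyssat point, `l = 13`.** [cite: Mochizuki2012, IUTchIV Cor. 2.2 (ii) proof (P6)(P7) p. 46]
[claim: Mochizuki2012, status: disputed] -/
theorem not_hStarSzpiroBadCut_of_condP6_of_nonempty_reyssat_l13 (h6 : Cor22.CondP6 (ratPoint (((2 : ℕ) : ℚ) / ((6436343 : ℕ) : ℚ))) 13)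
    (hT : Nonempty (Cor22.ThetaVolumeDatumAt (ratPoint (((2 : ℕ) : ℚ) / ((6436343 : ℕ) : ℚ))) 13)) : ¬ HStarSzpiroBadCut :=
  fun hH => (isEmpty_thetaVolumeDatumAt_reyssat_l13_of_hStar hH h6).false hT.some

/-- **(P2) at `(λ_R, 17)`**: `17` divides no local height (`h ∈ {20, 10, 2}`). [cite: Mochizuki2012, IUTchIV Cor. 2.2 (ii) proof (P2) p. 45] [claim: Mochizuki2012, status: disputed] -/
theorem condP2_reyssat_l17 : Cor22.CondP2 (ratPoint (((2 : ℕ) : ℚ) / ((6436343 : ℕ) : ℚ))) 17 := by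
  obtain ⟨hI, -, hD, hj, hN, hcop, -⟩ := factorisation_reyssat
  refine condP2_ratPoint_of_factorisation hI hD hj hN hcop fun p hp => ?_
  simp only [Finset.mem_insert, Finset.mem_singleton] at hp
  rcases hp with rfl | rfl | rfl <;> norm_num

/-- **(P5) at `(λ_R, 17)`**: the place over `23` is bad and divides neither `2` nor `17`. [cite: Mochizuki2012, IUTchIV Cor. 2.2 (ii) proof (P5) p. 46] [claim: Mochizuki2012, status: disputed] -/
theorem condP5_reyssat_l17 : Cor22.CondP5 (ratPoint (((2 : ℕ) : ℚ) / ((6436343 : ℕ) : ℚ))) 17 := by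
  obtain ⟨hI, he, hD, hj, hN, hcop, -⟩ := factorisation_reyssat
  exact condP5_ratPoint_of_factorisation hI he hD hj hN hcop (p₀ := 23) (by decide) (by norm_num) (by norm_num)

/-- **SZPIRO-BAD at `(λ_R, 17)`** — the disjunction of the cut certificate p450130 HOLDS (second disjunct, `d_mod = 1`), by the TIGHT certificate of part 3
with `(C, A, B) = (3, 18, 23)`: `(∏_{p ≠ 17} p)^18·63^23 < 20^23·∏_{p ≠ 17} p^{3·h_p}`. [cite: Mochizuki2012, IUTchIV Thm. 1.10 p. 22–23, Cor. 2.2 (ii) proof p. 46]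
[claim: Mochizuki2012, status: disputed] -/
theorem szpiroBad_reyssat_l17 :
    (((17 : ℕ) : ℝ) + 5) / 4 < (Cor22.dmod (ratPoint (((2 : ℕ) : ℚ) / ((6436343 : ℕ) : ℚ))) : ℝ) ∨
      6 * (17 : ℕ) * ((((17 : ℕ) : ℝ) + 5) - 4 * Cor22.dmod (ratPoint (((2 : ℕ) : ℚ) / ((6436343 : ℕ) : ℚ)))) / ((((17 : ℕ) : ℝ) + 4) * (((17 : ℕ) : ℝ) - 3))
          * ((ratPoint (((2 : ℕ) : ℚ) / ((6436343 : ℕ) : ℚ))).logDiff + (1 - 1 / ((17 : ℕ) : ℝ)) * Cor22.logCondAvoid (ratPoint (((2 : ℕ) : ℚ) / ((6436343 : ℕ) : ℚ))) {2, 17})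
        + 6 * (17 : ℕ) * (((17 : ℕ) : ℝ) + 5) / ((((17 : ℕ) : ℝ) + 4) * (((17 : ℕ) : ℝ) - 3)) * Real.log Real.pi < Cor22.logQAvoid (ratPoint (((2 : ℕ) : ℚ) / ((6436343 : ℕ) : ℚ))) {2, 17} := by
  obtain ⟨hI, he, hD, hj, hN, hcop, h2⟩ := factorisation_reyssat
  refine szpiroBad_ratPoint_of_certificate_tight' hI he hD hj hN hcop h2 (by norm_num) (by norm_num) (A := 18) (B := 23) (C := 3)
    (by norm_num) (by norm_num) (by norm_num) ?_
  rw [show (({3, 23, 109} : Finset ℕ)).erase 17 = ({3, 23, 109} : Finset ℕ) by decide]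
  rw [Finset.prod_insert (by decide), Finset.prod_insert (by decide), Finset.prod_singleton, Finset.prod_insert (by decide), Finset.prod_insert (by decide), Finset.prod_singleton]
  norm_num

/-- **EVERY Θ-volume datum at `(λ_R, 17)` is in the WINDOW** (¬deep, VERBATIM) by part 3's DEGREE-AWARE criterion: `[K:ℚ] ≥ 17·(17²−1)`, exponents
`k = (fun p : ℕ => if p = 3 then 7 else if p = 23 then 2 else if p = 109 then 1 else 0)`, and `h_p·(17−3)(17+1) ≤ 8·17·((17+1)(k_p+2)+1)` at `p = 3, 23, 109`.
Existence of such a datum NOT claimed. [cite: Mochizuki2012, IUTchIII Cor. 3.12 p. 173–174; IUTchIV Thm. 1.10 p. 22–24; IUTchI Def. 3.1 (c) p. 61]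
[claim: Mochizuki2012, status: disputed] -/
theorem not_deep_reyssat_l17 (T : Cor22.ThetaVolumeDatumAt (ratPoint (((2 : ℕ) : ℚ) / ((6436343 : ℕ) : ℚ))) 17) :
    letI := T.instFieldF; letI := T.instNumberFieldF; letI := T.instAlgebraF; letI := T.instFieldK
    letI := T.instNumberFieldK; letI := T.instAlgebraK; letI := T.instFieldFbar; letI := T.instAlgebraFbar
    letI := T.instAlgebraKFbar; letI := T.instIsElliptic
    ¬ (∃ (pp : Nat.Primes) (_ : 2 < (pp : ℕ)) (i : Fin (thetaIndex (pilotDataOfK T.D T.K)).lstar)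
        (x₀ : (thetaIndex (pilotDataOfK T.D T.K)).Fibre (.inr pp)),
      haveI : Fact (pp : ℕ).Prime := ⟨pp.2⟩
      ((pp : ℕ) : ℝ) ^ ((((i : ℕ) : ℝ) + 2) * (4 + 2 * Real.logb (pp : ℕ) (Module.finrank ℚ T.K)) + 1) *
        ‖(exists_realising_qIdeles_pilotDataOfK T.D).choose pp x₀‖ ^ (((i : ℕ) + 1) ^ 2 - 1) < 1) := by
  obtain ⟨hI, -, hD, hj, hN, hcop, -⟩ := factorisation_reyssat
  refine not_deep_ratPoint_of_factorisation_of_pow_le T hI hD hj hN hcop (fun p : ℕ => if p = 3 then 7 else if p = 23 then 2 else if p = 109 then 1 else 0) (fun p _ => ?_) (fun p hp => ?_)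
  · split_ifs <;> subst_vars <;> norm_num
  · simp only [Finset.mem_insert, Finset.mem_singleton] at hp
    rcases hp with rfl | rfl | rfl <;> norm_num

/-- **`H⋆₂` FORBIDS Θ-DATA AT `(λ_R, 17)` GIVEN (P6)**: under `HStarSzpiroBadCut` and (P6) at `(λ_R, 17)` the type of genuine Θ-volume data there is
EMPTY (admissible-minus-(P6), Szpiro-bad, window — all kernel above; the I06⋆ cells refused by gen 0's `not_i06StarCellsAt_F02_l17`).
[cite: Mochizuki2012, IUTchIV Cor. 2.2 (ii) proof (P6)(P7) p. 46; IUTchIII Rmk. 3.12.2 (ii) p. 191] [claim: Mochizuki2012, status: disputed] -/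
theorem isEmpty_thetaVolumeDatumAt_reyssat_l17_of_hStar (hH : HStarSzpiroBadCut) (h6 : Cor22.CondP6 (ratPoint (((2 : ℕ) : ℚ) / ((6436343 : ℕ) : ℚ))) 17) :
    IsEmpty (Cor22.ThetaVolumeDatumAt (ratPoint (((2 : ℕ) : ℚ) / ((6436343 : ℕ) : ℚ))) 17) :=
  ⟨fun T => not_i06StarCellsAt_F02_l17 T
    (hH _ ratPoint_reyssat_mem_UP 17 (by norm_num) (by norm_num) admitsCore_reyssat condP2_reyssat_l17 condP5_reyssat_l17 h6
      szpiroBad_reyssat_l17 T (not_deep_reyssat_l17 T))⟩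

/-- **`¬ H⋆₂` MODULO EXACTLY (P6) AND (P7)-EXISTENCE at the Reyssat point, `l = 17`.** [cite: Mochizuki2012, IUTchIV Cor. 2.2 (ii) proof (P6)(P7) p. 46]
[claim: Mochizuki2012, status: disputed] -/
theorem not_hStarSzpiroBadCut_of_condP6_of_nonempty_reyssat_l17 (h6 : Cor22.CondP6 (ratPoint (((2 : ℕ) : ℚ) / ((6436343 : ℕ) : ℚ))) 17)
    (hT : Nonempty (Cor22.ThetaVolumeDatumAt (ratPoint (((2 : ℕ) : ℚ) / ((6436343 : ℕ) : ℚ))) 17)) : ¬ HStarSzpiroBadCut :=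
  fun hH => (isEmpty_thetaVolumeDatumAt_reyssat_l17_of_hStar hH h6).false hT.some

/-- **(P2) at `(λ_R, 19)`**: `19` divides no local height (`h ∈ {20, 10, 2}`). [cite: Mochizuki2012, IUTchIV Cor. 2.2 (ii) proof (P2) p. 45] [claim: Mochizuki2012, status: disputed] -/
theorem condP2_reyssat_l19 : Cor22.CondP2 (ratPoint (((2 : ℕ) : ℚ) / ((6436343 : ℕ) : ℚ))) 19 := by
  obtain ⟨hI, -, hD, hj, hN, hcop, -⟩ := factorisation_reyssat
  refine condP2_ratPoint_of_factorisation hI hD hj hN hcop fun p hp => ?_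
  simp only [Finset.mem_insert, Finset.mem_singleton] at hp
  rcases hp with rfl | rfl | rfl <;> norm_num

/-- **(P5) at `(λ_R, 19)`**: the place over `23` is bad and divides neither `2` nor `19`. [cite: Mochizuki2012, IUTchIV Cor. 2.2 (ii) proof (P5) p. 46] [claim: Mochizuki2012, status: disputed] -/
theorem condP5_reyssat_l19 : Cor22.CondP5 (ratPoint (((2 : ℕ) : ℚ) / ((6436343 : ℕ) : ℚ))) 19 := by
  obtain ⟨hI, he, hD, hj, hN, hcop, -⟩ := factorisation_reyssat
  exact condP5_ratPoint_of_factorisation hI he hD hj hN hcop (p₀ := 23) (by decide) (by norm_num) (by norm_num)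

/-- **SZPIRO-BAD at `(λ_R, 19)`** — the disjunction of the cut certificate p450130 HOLDS (second disjunct, `d_mod = 1`), by the TIGHT certificate of part 3
with `(C, A, B) = (2, 12, 15)`: `(∏_{p ≠ 19} p)^12·63^15 < 20^15·∏_{p ≠ 19} p^{2·h_p}`. [cite: Mochizuki2012, IUTchIV Thm. 1.10 p. 22–23, Cor. 2.2 (ii) proof p. 46]
[claim: Mochizuki2012, status: disputed] -/
theorem szpiroBad_reyssat_l19 :
    (((19 : ℕ) : ℝ) + 5) / 4 < (Cor22.dmod (ratPoint (((2 : ℕ) : ℚ) / ((6436343 : ℕ) : ℚ))) : ℝ) ∨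
      6 * (19 : ℕ) * ((((19 : ℕ) : ℝ) + 5) - 4 * Cor22.dmod (ratPoint (((2 : ℕ) : ℚ) / ((6436343 : ℕ) : ℚ)))) / ((((19 : ℕ) : ℝ) + 4) * (((19 : ℕ) : ℝ) - 3))
          * ((ratPoint (((2 : ℕ) : ℚ) / ((6436343 : ℕ) : ℚ))).logDiff + (1 - 1 / ((19 : ℕ) : ℝ)) * Cor22.logCondAvoid (ratPoint (((2 : ℕ) : ℚ) / ((6436343 : ℕ) : ℚ))) {2, 19})
        + 6 * (19 : ℕ) * (((19 : ℕ) : ℝ) + 5) / ((((19 : ℕ) : ℝ) + 4) * (((19 : ℕ) : ℝ) - 3)) * Real.log Real.pi < Cor22.logQAvoid (ratPoint (((2 : ℕ) : ℚ) / ((6436343 : ℕ) : ℚ))) {2, 19} := by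
  obtain ⟨hI, he, hD, hj, hN, hcop, h2⟩ := factorisation_reyssat
  refine szpiroBad_ratPoint_of_certificate_tight' hI he hD hj hN hcop h2 (by norm_num) (by norm_num) (A := 12) (B := 15) (C := 2)
    (by norm_num) (by norm_num) (by norm_num) ?_
  rw [show (({3, 23, 109} : Finset ℕ)).erase 19 = ({3, 23, 109} : Finset ℕ) by decide]
  rw [Finset.prod_insert (by decide), Finset.prod_insert (by decide), Finset.prod_singleton, Finset.prod_insert (by decide), Finset.prod_insert (by decide), Finset.prod_singleton]
  norm_num

/-- **EVERY Θ-volume datum at `(λ_R, 19)` is in the WINDOW** (¬deep, VERBATIM) by part 3's DEGREE-AWARE criterion: `[K:ℚ] ≥ 19·(19²−1)`, exponents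
`k = (fun p : ℕ => if p = 3 then 8 else if p = 23 then 2 else if p = 109 then 1 else 0)`, and `h_p·(19−3)(19+1) ≤ 8·19·((19+1)(k_p+2)+1)` at `p = 3, 23, 109`.
Existence of such a datum NOT claimed. [cite: Mochizuki2012, IUTchIII Cor. 3.12 p. 173–174; IUTchIV Thm. 1.10 p. 22–24; IUTchI Def. 3.1 (c) p. 61]
[claim: Mochizuki2012, status: disputed] -/
theorem not_deep_reyssat_l19 (T : Cor22.ThetaVolumeDatumAt (ratPoint (((2 : ℕ) : ℚ) / ((6436343 : ℕ) : ℚ))) 19) :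
    letI := T.instFieldF; letI := T.instNumberFieldF; letI := T.instAlgebraF; letI := T.instFieldK
    letI := T.instNumberFieldK; letI := T.instAlgebraK; letI := T.instFieldFbar; letI := T.instAlgebraFbar
    letI := T.instAlgebraKFbar; letI := T.instIsElliptic
    ¬ (∃ (pp : Nat.Primes) (_ : 2 < (pp : ℕ)) (i : Fin (thetaIndex (pilotDataOfK T.D T.K)).lstar)
        (x₀ : (thetaIndex (pilotDataOfK T.D T.K)).Fibre (.inr pp)),
      haveI : Fact (pp : ℕ).Prime := ⟨pp.2⟩
      ((pp : ℕ) : ℝ) ^ ((((i : ℕ) : ℝ) + 2) * (4 + 2 * Real.logb (pp : ℕ) (Module.finrank ℚ T.K)) + 1) *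
        ‖(exists_realising_qIdeles_pilotDataOfK T.D).choose pp x₀‖ ^ (((i : ℕ) + 1) ^ 2 - 1) < 1) := by
  obtain ⟨hI, -, hD, hj, hN, hcop, -⟩ := factorisation_reyssat
  refine not_deep_ratPoint_of_factorisation_of_pow_le T hI hD hj hN hcop (fun p : ℕ => if p = 3 then 8 else if p = 23 then 2 else if p = 109 then 1 else 0) (fun p _ => ?_) (fun p hp => ?_)
  · split_ifs <;> subst_vars <;> norm_num
  · simp only [Finset.mem_insert, Finset.mem_singleton] at hp
    rcases hp with rfl | rfl | rfl <;> norm_num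

/-- **`H⋆₂` FORBIDS Θ-DATA AT `(λ_R, 19)` GIVEN (P6)**: under `HStarSzpiroBadCut` and (P6) at `(λ_R, 19)` the type of genuine Θ-volume data there is
EMPTY (admissible-minus-(P6), Szpiro-bad, window — all kernel above; the I06⋆ cells refused by gen 0's `not_i06StarCellsAt_F02_l19`).
[cite: Mochizuki2012, IUTchIV Cor. 2.2 (ii) proof (P6)(P7) p. 46; IUTchIII Rmk. 3.12.2 (ii) p. 191] [claim: Mochizuki2012, status: disputed] -/
theorem isEmpty_thetaVolumeDatumAt_reyssat_l19_of_hStar (hH : HStarSzpiroBadCut) (h6 : Cor22.CondP6 (ratPoint (((2 : ℕ) : ℚ) / ((6436343 : ℕ) : ℚ))) 19) :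
    IsEmpty (Cor22.ThetaVolumeDatumAt (ratPoint (((2 : ℕ) : ℚ) / ((6436343 : ℕ) : ℚ))) 19) :=
  ⟨fun T => not_i06StarCellsAt_F02_l19 T
    (hH _ ratPoint_reyssat_mem_UP 19 (by norm_num) (by norm_num) admitsCore_reyssat condP2_reyssat_l19 condP5_reyssat_l19 h6
      szpiroBad_reyssat_l19 T (not_deep_reyssat_l19 T))⟩

/-- **`¬ H⋆₂` MODULO EXACTLY (P6) AND (P7)-EXISTENCE at the Reyssat point, `l = 19`.** [cite: Mochizuki2012, IUTchIV Cor. 2.2 (ii) proof (P6)(P7) p. 46]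
[claim: Mochizuki2012, status: disputed] -/
theorem not_hStarSzpiroBadCut_of_condP6_of_nonempty_reyssat_l19 (h6 : Cor22.CondP6 (ratPoint (((2 : ℕ) : ℚ) / ((6436343 : ℕ) : ℚ))) 19)
    (hT : Nonempty (Cor22.ThetaVolumeDatumAt (ratPoint (((2 : ℕ) : ℚ) / ((6436343 : ℕ) : ℚ))) 19)) : ¬ HStarSzpiroBadCut :=
  fun hH => (isEmpty_thetaVolumeDatumAt_reyssat_l19_of_hStar hH h6).false hT.some

/-- **(P2) at `(λ_R, 109)`**: `109` divides no local height (`h ∈ {20, 10, 2}`). [cite: Mochizuki2012, IUTchIV Cor. 2.2 (ii) proof (P2) p. 45] [claim: Mochizuki2012, status: disputed] -/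
theorem condP2_reyssat_l109 : Cor22.CondP2 (ratPoint (((2 : ℕ) : ℚ) / ((6436343 : ℕ) : ℚ))) 109 := by
  obtain ⟨hI, -, hD, hj, hN, hcop, -⟩ := factorisation_reyssat
  refine condP2_ratPoint_of_factorisation hI hD hj hN hcop fun p hp => ?_
  simp only [Finset.mem_insert, Finset.mem_singleton] at hp
  rcases hp with rfl | rfl | rfl <;> norm_num

/-- **(P5) at `(λ_R, 109)`**: the place over `23` is bad and divides neither `2` nor `109`. [cite: Mochizuki2012, IUTchIV Cor. 2.2 (ii) proof (P5) p. 46] [claim: Mochizuki2012, status: disputed] -/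
theorem condP5_reyssat_l109 : Cor22.CondP5 (ratPoint (((2 : ℕ) : ℚ) / ((6436343 : ℕ) : ℚ))) 109 := by
  obtain ⟨hI, he, hD, hj, hN, hcop, -⟩ := factorisation_reyssat
  exact condP5_ratPoint_of_factorisation hI he hD hj hN hcop (p₀ := 23) (by decide) (by norm_num) (by norm_num)

/-- **SZPIRO-BAD at `(λ_R, 109)`** — the disjunction of the cut certificate p450130 HOLDS (second disjunct, `d_mod = 1`), by the TIGHT certificate of part 3
with `(C, A, B) = (1, 6, 7)`: `(∏_{p ≠ 109} p)^6·63^7 < 20^7·∏_{p ≠ 109} p^{1·h_p}`. [cite: Mochizuki2012, IUTchIV Thm. 1.10 p. 22–23, Cor. 2.2 (ii) proof p. 46]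
[claim: Mochizuki2012, status: disputed] -/
theorem szpiroBad_reyssat_l109 :
    (((109 : ℕ) : ℝ) + 5) / 4 < (Cor22.dmod (ratPoint (((2 : ℕ) : ℚ) / ((6436343 : ℕ) : ℚ))) : ℝ) ∨
      6 * (109 : ℕ) * ((((109 : ℕ) : ℝ) + 5) - 4 * Cor22.dmod (ratPoint (((2 : ℕ) : ℚ) / ((6436343 : ℕ) : ℚ)))) / ((((109 : ℕ) : ℝ) + 4) * (((109 : ℕ) : ℝ) - 3))
          * ((ratPoint (((2 : ℕ) : ℚ) / ((6436343 : ℕ) : ℚ))).logDiff + (1 - 1 / ((109 : ℕ) : ℝ)) * Cor22.logCondAvoid (ratPoint (((2 : ℕ) : ℚ) / ((6436343 : ℕ) : ℚ))) {2, 109})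
        + 6 * (109 : ℕ) * (((109 : ℕ) : ℝ) + 5) / ((((109 : ℕ) : ℝ) + 4) * (((109 : ℕ) : ℝ) - 3)) * Real.log Real.pi < Cor22.logQAvoid (ratPoint (((2 : ℕ) : ℚ) / ((6436343 : ℕ) : ℚ))) {2, 109} := by
  obtain ⟨hI, he, hD, hj, hN, hcop, h2⟩ := factorisation_reyssat
  refine szpiroBad_ratPoint_of_certificate_tight' hI he hD hj hN hcop h2 (by norm_num) (by norm_num) (A := 6) (B := 7) (C := 1)
    (by norm_num) (by norm_num) (by norm_num) ?_
  rw [show (({3, 23, 109} : Finset ℕ)).erase 109 = ({3, 23} : Finset ℕ) by decide]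
  rw [Finset.prod_insert (by decide), Finset.prod_singleton, Finset.prod_insert (by decide), Finset.prod_singleton]
  norm_num

/-- **EVERY Θ-volume datum at `(λ_R, 109)` is in the WINDOW** (¬deep, VERBATIM) by part 3's DEGREE-AWARE criterion: `[K:ℚ] ≥ 109·(109²−1)`, exponents
`k = (fun p : ℕ => if p = 3 then 12 else if p = 23 then 4 else if p = 109 then 1 else 0)`, and `h_p·(109−3)(109+1) ≤ 8·109·((109+1)(k_p+2)+1)` at `p = 3, 23, 109`.
Existence of such a datum NOT claimed. [cite: Mochizuki2012, IUTchIII Cor. 3.12 p. 173–174; IUTchIV Thm. 1.10 p. 22–24; IUTchI Def. 3.1 (c) p. 61]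
[claim: Mochizuki2012, status: disputed] -/
theorem not_deep_reyssat_l109 (T : Cor22.ThetaVolumeDatumAt (ratPoint (((2 : ℕ) : ℚ) / ((6436343 : ℕ) : ℚ))) 109) :
    letI := T.instFieldF; letI := T.instNumberFieldF; letI := T.instAlgebraF; letI := T.instFieldK
    letI := T.instNumberFieldK; letI := T.instAlgebraK; letI := T.instFieldFbar; letI := T.instAlgebraFbar
    letI := T.instAlgebraKFbar; letI := T.instIsElliptic
    ¬ (∃ (pp : Nat.Primes) (_ : 2 < (pp : ℕ)) (i : Fin (thetaIndex (pilotDataOfK T.D T.K)).lstar)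
        (x₀ : (thetaIndex (pilotDataOfK T.D T.K)).Fibre (.inr pp)),
      haveI : Fact (pp : ℕ).Prime := ⟨pp.2⟩
      ((pp : ℕ) : ℝ) ^ ((((i : ℕ) : ℝ) + 2) * (4 + 2 * Real.logb (pp : ℕ) (Module.finrank ℚ T.K)) + 1) *
        ‖(exists_realising_qIdeles_pilotDataOfK T.D).choose pp x₀‖ ^ (((i : ℕ) + 1) ^ 2 - 1) < 1) := by
  obtain ⟨hI, -, hD, hj, hN, hcop, -⟩ := factorisation_reyssat
  refine not_deep_ratPoint_of_factorisation_of_pow_le T hI hD hj hN hcop (fun p : ℕ => if p = 3 then 12 else if p = 23 then 4 else if p = 109 then 1 else 0) (fun p _ => ?_) (fun p hp => ?_)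
  · split_ifs <;> subst_vars <;> norm_num
  · simp only [Finset.mem_insert, Finset.mem_singleton] at hp
    rcases hp with rfl | rfl | rfl <;> norm_num

/-- **`H⋆₂` FORBIDS Θ-DATA AT `(λ_R, 109)` GIVEN (P6)**: under `HStarSzpiroBadCut` and (P6) at `(λ_R, 109)` the type of genuine Θ-volume data there is
EMPTY (admissible-minus-(P6), Szpiro-bad, window — all kernel above; the I06⋆ cells refused by gen 0's `not_i06StarCellsAt_F02_l109`).
[cite: Mochizuki2012, IUTchIV Cor. 2.2 (ii) proof (P6)(P7) p. 46; IUTchIII Rmk. 3.12.2 (ii) p. 191] [claim: Mochizuki2012, status: disputed] -/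
theorem isEmpty_thetaVolumeDatumAt_reyssat_l109_of_hStar (hH : HStarSzpiroBadCut) (h6 : Cor22.CondP6 (ratPoint (((2 : ℕ) : ℚ) / ((6436343 : ℕ) : ℚ))) 109) :
    IsEmpty (Cor22.ThetaVolumeDatumAt (ratPoint (((2 : ℕ) : ℚ) / ((6436343 : ℕ) : ℚ))) 109) :=
  ⟨fun T => not_i06StarCellsAt_F02_l109 T
    (hH _ ratPoint_reyssat_mem_UP 109 (by norm_num) (by norm_num) admitsCore_reyssat condP2_reyssat_l109 condP5_reyssat_l109 h6
      szpiroBad_reyssat_l109 T (not_deep_reyssat_l109 T))⟩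

/-- **`¬ H⋆₂` MODULO EXACTLY (P6) AND (P7)-EXISTENCE at the Reyssat point, `l = 109`.** [cite: Mochizuki2012, IUTchIV Cor. 2.2 (ii) proof (P6)(P7) p. 46]
[claim: Mochizuki2012, status: disputed] -/
theorem not_hStarSzpiroBadCut_of_condP6_of_nonempty_reyssat_l109 (h6 : Cor22.CondP6 (ratPoint (((2 : ℕ) : ℚ) / ((6436343 : ℕ) : ℚ))) 109)
    (hT : Nonempty (Cor22.ThetaVolumeDatumAt (ratPoint (((2 : ℕ) : ℚ) / ((6436343 : ℕ) : ℚ))) 109)) : ¬ HStarSzpiroBadCut :=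
  fun hH => (isEmpty_thetaVolumeDatumAt_reyssat_l109_of_hStar hH h6).false hT.some

end Reyssat

end Summit.ABC.IUTFork.Repair.RHSzpiroBadCutFreyResidue

end
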